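import Literature.MathematicalPhysics.QuantumFieldTheory.Balaban1983to89.B9Prop26L2AtPinsOne
import Literature.MathematicalPhysics.QuantumFieldTheory.Balaban1983to89.B9BlockL2ReblockEngine
import Literature.MathematicalPhysics.QuantumFieldTheory.Balaban1983to89.B9Thm313WholeDirL2Z
import Literature.MathematicalPhysics.QuantumFieldTheory.Balaban1983to89.B9LettersHZAtOne

/-!
# `Balaban1983to89.B9Letters313AtOneL2` — [B9] Thm 3.13's BLOCK-L² reduction letters AT THE TRIVIAL BACKGROUND, first batch: the `G₀Q*` letters
# `Letters313L2PZ.gQs ∕ dGQs` (`‖1_{Δ(y)}G₀(1)Q*(1)ω‖ ≤ B₄·Lʲη·(n^{−1∕2}L^{j′}η)·e^{−δd}‖ω‖`, `‖1_{Δ(y)}∇G₀(1)Q*(1)ω‖ ≤ …`) HOLD AT `U = 1` at node00-def-Y's pinned letters — [4] (2.140)₀ + the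
# flat `Q*` source through the L² re-blocking engine and dag-n06-d's functor

T. Bałaban, *Propagators for lattice gauge theories in a background field*, Commun. Math. Phys. **99** (1985) 389–434
[`Balaban1985BackgroundPropagators`, "B9"]; [4] = T. Bałaban, *Propagators and renormalization transformations for lattice gauge
theories. II*, Commun. Math. Phys. **96** (1984) 223–250 [`Balaban1984PropagatorsII`].

statement-level skeleton of published theorems with citation tags; proofs where landed; nothing here is a claim about the Yang–Mills mass gap

THE PRINTED LOCI (verbatim).  [B9] p. 426 (Thm 3.13), (3.153); (3.46) p. 398 (the block `L²` members), (3.126) p. 420 («HB = GQ*(QGQ*)⁻¹B»); Cor. 3.5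
p. 407 («for U = 1 … proved in [4]»); [4] Prop. 2.6 (2.140) p. 247, (2.18)–(2.20) p. 226 (`Q`, `Q*`), (2.54) p. 233, Lemma 2.1 (2.60)–(2.61) p. 234.

THE POINT.  dag-n06-d's certificate (ed. 22) displays `hLL2 : … → Letters313L2PZ (𝔬12 x) (𝔡A x).Dd (𝔡A x).Dsd 1 (H x) B13₄ δ12₃ (fun y => √(wZ y)) … U ∧ …`
(dag-n06-l; `wZ` = the plateau `((L^{d+1})^{j(y)})⁻¹`, `√wZ = n^{−1∕2}`); no field had a `U = 1` inhabitant.  THIS FILE: §1 ★ `blockBd_coordOpKH_of_liftY` —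
a block-L² bound of the real letters is a block-L² bound of dag-n06-d's mixed coordinate model (slice-wise block maps, SAME kernel: the squared sizes add over
the slices); `blockBd_smul ∕ add ∕ sum ∕ neg`; §2 the flat `Q*` source — `qsK_supp` (spread `ℓ + 3`, dag-n06-h) and ★ `l2_qsK_le`: `‖Q*♭ω‖ ≤ √plateau(a′)·|ω(a′)|`
(`Σ q² ≤ max q·Σ q`, r03 `qwt_le`, n06-i `sum_qwt_eq_one`) — print's normalisation `n^{−1∕2}` = the certificate's pin `vZ`; §3 ★★ `blockBd_comp_qsK_bI`
(`B9BlockL2ReblockEngine.blockBd_comp_reblock` fed the `Q*` source) and ★★★ `blockBd_G0_Qstar_one` — the `gQs` shape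
`BlockBd 𝔬.blkZ 𝔬.blk (𝔬.G0 U₁ ∘ₗ 𝔬.Qstar U₁) (B·len y·(√wZ y′·len y′)·e^{−(¾δ−ε)d})` at ANY letter record pinned to `GcoK … O ∕ QscoKH … parB`
(`hG0co12 ∕ hQsco12`, `hblk12 ∕ hblkZ12`), `O(1)(J ⊗ E) = (GJ) ⊗ E`, transporters trivial at `1`, one power of `Lʲη` moved to the source block by (2.60), and
★★★ `blockBd_D_G0_Qstar_one` — the `dGQs` shape (`∇_UG₀Q*`, (2.140)₁, target `blkY = blkBK bI`, pin `hDco12`).  The `∂`-side letters `gDv ∕ dGDv` and the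
census-uniform packaging of all four are the sequel `B9Letters313AtOneL2Dv`.

HONEST SCOPE.  A READING file (N03's Prop. 2.6 (2.140) via `B9Prop26L2AtPinsOne.blockBd_Gop_kIdx`, p21's Lemma 2.1, (2.60), r1's `BlockBd` calculus — by
name); nothing of [B9] at curved `U` is asserted; the `∀U`-binder `hLL2` is NOT witnessed (A6 partial witness at `U = 1`); `c1` (C-letter), the `rgd*`
(R-letters) and the derivative letters are NOT treated here.  COUNT-NEUTRAL; N06 NOT discharged; one finite lattice at a time; nothing continuum, nothing
about the mass gap.  Cell `pub-ymgap` (HUMAN RULING D-0062 ∕ D-0149), node N06 [B9], rows 20–21 JSAT lane, width seat `pub-ymgap-dag-n06-w3` (g2), 2026-08-28.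
-/

noncomputable section

namespace Literature.MathematicalPhysics.QuantumFieldTheory.Balaban1983to89.B9Letters313AtOneL2

open B6MultiLevelTorusOperator (TDomains) open B6Geom246MultiLevelTorus (geomT) open B6GlobalChartV1 (PV blkV1 boxEquiv toBox)
open B6KLevelCensusIndexV1 (KIdx kGeo kGeoG) open B6Prop26Census2136KLevelV1 (Gop) open B6RandomWalk (HasMajorant BlockSupp blockPiece sum_blockPiece)
open B6RandomWalkHom (HasMajorantHom) open B6GradLegKLevelV1 (DV) open B6LapLegKLevelV1 (DVa DVa_apply) open B6Ineq2133TwoScaleV1 (onFun onFun_apply)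
open B6SectAOperatorsV1 (dE) open B10StarCount (shift_unshift unshift_shift shiftEquiv sum_pbond)
open B6Ineq2142KLevelV1 (lvl β qwt qwt_le qwt_nonneg) open B6Ineq288MultiLevelTorus (dist_symm_geoBT) open B9Thm314GpFlatMultiLevelTorus (consts_260_261)
open B6Lemma21Repaired (Ineq261With) open B9GeoNormsKLevelV1 (geo9K) open B9GeoLemma21KLevelV1 (one_le_Mh geo9K_len_pos geo9K_dist_comm geo9K_M_nonneg)
open B9Ineq349SiteComposite (distB distB_nonneg) open B9Ineq349SiteFromBlocks (distB_triangle) open B9Thm39ReadingCoords (cR39 cR39_nonneg)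
open B9CoReadingCoords B9CoReadingCoordsH open B9CoReadingCoordsS (XSK blkSK sIK blkV1_site) open B9Thm34Ext (toB6) open B9SectDL2Decay (bsq bl2 BlockBd)
open B9Eq3132Ineq2142Covariant (qK_apply sum_qwt_eq_one) open B9Prop26AtPinsOne (coordOpKH_apply_of_liftY)
open B9LettersHAtOneG0 (qsK_mulVec_apply qwt_le_one dist_blkV1_le_of_qwt_ne_zero GcoK_comp_QscoKH_one O_QsY_one_liftY DcoK_GcoK_comp_QscoKH_one cdB_O_QsY_one_liftY)
open B9Letters313AtOneQ (len_pow_le_of_transfer transfer_threshold) open B9LettersHZAtOne (plateau_pos)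
open B9Letters313AtOneDv (onFun_dE_eq_neg_sum_DVa distB_blkV1_shift_le_one GcoK_comp_DvcoKH_one O_gradY_one_liftY)
open B9Prop26L2AtPinsOne (blockBd_Gop_kIdx) open B9BlockL2ReblockEngine (blockBd_comp_reblock) open Node00 Node00.OpsYSectDCoords
open B9Thm312Whole B9Thm312WholeLeaf B9SectDSup B11SectG
open scoped Matrix

variable {d ℓ : ℕ} {hd : 1 ≤ d + 1} {hL : Odd (ℓ + 1) ∧ 1 < ℓ + 1} {b₀ b₁ : ℝ}

/-! ## §1 Block-L² bounds pass through dag-n06-d's coordinate functor slice by slice (no basis constant) -/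

section Slices

variable {𝔸 : Type} [NormedRing 𝔸] [NormedAlgebra ℂ 𝔸]
variable {κ : Type} [Fintype κ] [DecidableEq κ]
variable {S S' D : Type} [Fintype S] [Fintype S'] [Fintype D] (b : Module.Basis κ ℝ 𝔸) {G : B6.Geometry}

omit [DecidableEq κ] in
/-- the squared block size for the slice-wise block map is the sum of the squared block sizes of the slices. [cite: Balaban1984PropagatorsII, (2.54) p.233, bookkeeping] -/
theorem bsq_slicewise (blk : S' → G.Site) (y : G.Site) (μ : S' × D × κ × κ → ℝ) :
    bsq (g := G) (fun p : S' × D × κ × κ => blk p.1) y μ = ∑ ν : D, ∑ c : κ, ∑ c' : κ, bsq (g := G) blk y (fun z => μ (z, ν, c, c')) := by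
  classical
  simp only [bsq, Fintype.sum_prod_type]
  rw [Finset.sum_comm]
  refine Finset.sum_congr rfl fun ν _ => ?_
  rw [Finset.sum_comm]
  refine Finset.sum_congr rfl fun c _ => ?_
  rw [Finset.sum_comm]

omit [DecidableEq κ] in
/-- ★ **A TWO-SPACE BLOCK-L² BOUND OF THE REAL LETTERS IS A BLOCK-L² BOUND OF THE MIXED COORDINATE MODEL** (slice-wise block maps, the SAME kernel `N ≥ 0`):
the L² twin of dag-n06-h's `hasMajorantHom_coordOpKH_of_liftY`. [cite: Balaban1985BackgroundPropagators, (3.46) p.398; Balaban1984PropagatorsII, (2.54) p.233] -/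
theorem blockBd_coordOpKH_of_liftY {O : D → (S' → 𝔸) →ₗ[ℝ] (S → 𝔸)} {T : D → (S' → ℝ) →ₗ[ℝ] (S → ℝ)}
    (hO : ∀ (ν : D) (f : S' → ℝ) (E : 𝔸), O ν (liftY f E) = liftY (T ν f) E) {blk' : S' → G.Site} {blk : S → G.Site}
    {N : G.Site → G.Site → ℝ} (hN : ∀ a a', 0 ≤ N a a') (hK : ∀ ν, BlockBd (g := G) blk' blk (T ν) N) :
    BlockBd (g := G) (fun p : S' × D × κ × κ => blk' p.1) (fun p : S × D × κ × κ => blk p.1) (coordOpKH b O) N := by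
  classical
  intro a' μ hμ a
  have hslice : ∀ (ν : D) (c c' : κ), (fun z => coordOpKH b O μ (z, ν, c, c')) = T ν (fun z => μ (z, ν, c, c')) := by
    intro ν c c'; funext z; exact coordOpKH_apply_of_liftY b hO μ (z, ν, c, c')
  have hsupp : ∀ (ν : D) (c c' : κ), ∀ z, blk' z ≠ a' → (fun z => μ (z, ν, c, c')) z = 0 := fun ν c c' z hz => hμ (z, ν, c, c') hz
  -- squared sizes, slice by slice
  have hsq : bsq (g := G) (fun p : S × D × κ × κ => blk p.1) a (coordOpKH b O μ) ≤ N a a' ^ 2 * bsq (g := G) (fun p : S' × D × κ × κ => blk' p.1) a' μ := by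
    rw [bsq_slicewise, bsq_slicewise, Finset.mul_sum]
    refine Finset.sum_le_sum fun ν _ => ?_
    rw [Finset.mul_sum]
    refine Finset.sum_le_sum fun c _ => ?_
    rw [Finset.mul_sum]
    refine Finset.sum_le_sum fun c' _ => ?_
    have h1 := hK ν a' _ (hsupp ν c c') a
    have e1 : bsq (g := G) blk a (fun z => coordOpKH b O μ (z, ν, c, c')) = bsq (g := G) blk a (T ν (fun z => μ (z, ν, c, c'))) := by rw [hslice]
    rw [e1, ← B9SectDL2Decay.bl2_sq, ← B9SectDL2Decay.bl2_sq, ← mul_pow]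
    exact pow_le_pow_left₀ (B9SectDL2Decay.bl2_nonneg _ _ _) h1 2
  unfold bl2
  calc Real.sqrt (bsq (g := G) (fun p : S × D × κ × κ => blk p.1) a (coordOpKH b O μ))
      ≤ Real.sqrt (N a a' ^ 2 * bsq (g := G) (fun p : S' × D × κ × κ => blk' p.1) a' μ) := Real.sqrt_le_sqrt hsq
    _ = N a a' * Real.sqrt (bsq (g := G) (fun p : S' × D × κ × κ => blk' p.1) a' μ) := by
        rw [Real.sqrt_mul (sq_nonneg _), Real.sqrt_sq (hN a a')]

omit [DecidableEq κ] in
/-- a non-negative multiple of an operator with a block-L² bound. [cite: Balaban1984PropagatorsII, (2.51) p.232, bookkeeping] -/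
theorem blockBd_smul_of_nonneg {X V : Type} [Fintype X] [Fintype V] {blkX : X → G.Site} {blkV : V → G.Site}
    {T : (X → ℝ) →ₗ[ℝ] (V → ℝ)} {N : G.Site → G.Site → ℝ} (h : BlockBd (g := G) blkX blkV T N) {r : ℝ} (hr : 0 ≤ r) :
    BlockBd (g := G) blkX blkV (r • T) (fun a a' => r * N a a') := by
  intro y' μ hμ v
  rw [LinearMap.smul_apply, B9SectDL2Decay.bl2_smul, abs_of_nonneg hr, mul_assoc]
  exact mul_le_mul_of_nonneg_left (h y' μ hμ v) hr

end Slices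

section Sums

variable {G : B6.Geometry} {X V : Type} [Fintype X] [Fintype V]

/-- block-L² bounds add. [cite: Balaban1984PropagatorsII, (2.54) p.233, bookkeeping] -/
theorem blockBd_add {blkX : X → G.Site} {blkV : V → G.Site} {T₁ T₂ : (X → ℝ) →ₗ[ℝ] (V → ℝ)} {N₁ N₂ : G.Site → G.Site → ℝ}
    (h₁ : BlockBd (g := G) blkX blkV T₁ N₁) (h₂ : BlockBd (g := G) blkX blkV T₂ N₂) :
    BlockBd (g := G) blkX blkV (T₁ + T₂) (fun a a' => N₁ a a' + N₂ a a') := by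
  intro y' μ hμ v
  rw [LinearMap.add_apply, add_mul]
  exact (B9SectDL2Decay.bl2_add_le _ _ _ _).trans (add_le_add (h₁ y' μ hμ v) (h₂ y' μ hμ v))

/-- block-L² bounds of finite sums of operators. [cite: Balaban1984PropagatorsII, (2.54) p.233, bookkeeping] -/
theorem blockBd_sum {blkX : X → G.Site} {blkV : V → G.Site} {ι : Type} (s : Finset ι) {T : ι → (X → ℝ) →ₗ[ℝ] (V → ℝ)}
    {N : G.Site → G.Site → ℝ} (h : ∀ j ∈ s, BlockBd (g := G) blkX blkV (T j) N) :
    BlockBd (g := G) blkX blkV (∑ j ∈ s, T j) (fun a a' => (s.card : ℝ) * N a a') := by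
  classical
  induction s using Finset.induction_on with
  | empty =>
      intro y' μ hμ v
      simp only [Finset.sum_empty, LinearMap.zero_apply, Finset.card_empty, Nat.cast_zero, zero_mul]
      have : bl2 (g := G) blkV v (0 : V → ℝ) = 0 := by unfold bl2 bsq; simp
      rw [this]
  | insert j s hj ih =>
      intro y' μ hμ v
      rw [Finset.sum_insert hj, Finset.card_insert_of_notMem hj, LinearMap.add_apply, Nat.cast_add, Nat.cast_one]
      have h1 := h j (Finset.mem_insert_self j s) y' μ hμ v
      have h2 : bl2 (g := G) blkV v ((∑ k ∈ s, T k) μ) ≤ (s.card : ℝ) * N v y' * bl2 (g := G) blkX y' μ :=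
        ih (fun k hk => h k (Finset.mem_insert_of_mem hk)) y' μ hμ v
      refine (B9SectDL2Decay.bl2_add_le _ _ _ _).trans ?_
      linarith [h1, h2]

/-- block-L² bounds are invariant under negation. [cite: Balaban1984PropagatorsII, (2.54) p.233, bookkeeping] -/
theorem blockBd_neg {blkX : X → G.Site} {blkV : V → G.Site} {T : (X → ℝ) →ₗ[ℝ] (V → ℝ)} {N : G.Site → G.Site → ℝ}
    (h : BlockBd (g := G) blkX blkV T N) : BlockBd (g := G) blkX blkV (-T) N := by
  intro y' μ hμ v
  rw [LinearMap.neg_apply, B9SectDL2Decay.bl2_neg]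
  exact h y' μ hμ v

end Sums

/-! ## §2 The two sources on the torus chart: the flat `Q*` kernel (spread `ℓ + 3`, norm factor `√plateau = n^{−1∕2}`) and the direction slices of a scalar
(spread `2`, norm factor `1`) -/

section Sources

variable (i : KIdx d ℓ hd hL b₀ b₁)

/-- the image of a one-point coarse function under the flat `Q*` kernel is supported within torus distance `ℓ + 3` of its carrier block.
[cite: Balaban1984PropagatorsII, (2.45)–(2.46) p.231] -/
theorem qsK_supp {a' : IBondY i} {ω : IBondY i → ℝ} (hω : ∀ y, (fun y : IBondY i => y) y ≠ a' → ω y = 0) (z : FBondY i)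
    (hz : Matrix.toLin' (qsK i) ω z ≠ 0) : distB i (β i.hN i.D i.hk a') (blkV1 i.hN i.D z) ≤ (ℓ : ℝ) + 3 := by
  rw [Matrix.toLin'_apply, qsK_mulVec_apply, Finset.sum_eq_single a'] at hz
  · exact dist_blkV1_le_of_qwt_ne_zero i (left_ne_zero_of_mul hz)
  · intro y _ hy; rw [hω y hy, mul_zero]
  · intro h; exact absurd (Finset.mem_univ _) h

/-- ★ **THE FLAT `L²` NORM OF `Q*♭ω` FOR A ONE-POINT `ω`**: `‖Q*♭ω‖ ≤ √(plateau(a′))·|ω(a′)|` — `Σ_f q_{a′}(f)² ≤ max q · Σ q = (L^{d+1})^{−j(a′)}·1`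
(r03's `qwt_le` and dag-n06-i's `sum_qwt_eq_one`); `√plateau = n^{−1∕2}` is the certificate's pin `vZ`. [cite: Balaban1984PropagatorsI, (1.18) p.20; Balaban1984PropagatorsII, (2.18)–(2.20) p.226, (2.54) p.233] -/
theorem l2_qsK_le {a' : IBondY i} {ω : IBondY i → ℝ} (hω : ∀ y, (fun y : IBondY i => y) y ≠ a' → ω y = 0) (R₀ : ℝ) (H₀ : Prop)
    [Fintype (geo9K i).Site] :
    Real.sqrt (∑ z, Matrix.toLin' (qsK i) ω z ^ 2) ≤
      Real.sqrt (((((ℓ + 1 : ℕ) : ℝ) ^ (d + 1)) ^ lvl i.hN i.D i.hk a')⁻¹) * bl2 (g := toB6 (geo9K i) R₀ H₀) (fun y : IBondY i => y) a' ω := by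
  classical
  have hv : ∀ z, Matrix.toLin' (qsK i) ω z = qwt i.hN i.D i.hk a' z * ω a' := fun z => by
    rw [Matrix.toLin'_apply, qsK_mulVec_apply, Finset.sum_eq_single a']
    · intro y _ hy; rw [hω y hy, mul_zero]
    · intro h; exact absurd (Finset.mem_univ _) h
  set pl : ℝ := ((((ℓ + 1 : ℕ) : ℝ) ^ (d + 1)) ^ lvl i.hN i.D i.hk a')⁻¹ with hpl
  have hpl0 : 0 < pl := plateau_pos i a'
  have hsum : ∑ z, Matrix.toLin' (qsK i) ω z ^ 2 ≤ pl * ω a' ^ 2 := by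
    calc ∑ z, Matrix.toLin' (qsK i) ω z ^ 2 = ∑ z, qwt i.hN i.D i.hk a' z ^ 2 * ω a' ^ 2 := by
          refine Finset.sum_congr rfl fun z _ => ?_; rw [hv, mul_pow]
      _ ≤ ∑ z, (pl * qwt i.hN i.D i.hk a' z) * ω a' ^ 2 := Finset.sum_le_sum fun z _ => by
          refine mul_le_mul_of_nonneg_right ?_ (sq_nonneg _)
          rw [sq]
          exact mul_le_mul_of_nonneg_right (qwt_le i.hN i.D i.hk a' z) (qwt_nonneg i.hN i.D i.hk a' z)
      _ = pl * ω a' ^ 2 * ∑ z, qwt i.hN i.D i.hk a' z := by rw [Finset.mul_sum]; refine Finset.sum_congr rfl fun z _ => ?_; ring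
      _ = pl * ω a' ^ 2 := by rw [sum_qwt_eq_one, mul_one]
  have hbl2 : bl2 (g := toB6 (geo9K i) R₀ H₀) (fun y : IBondY i => y) a' ω = |ω a'| := by
    unfold bl2 bsq
    rw [Finset.sum_eq_single a']
    · simp [Real.sqrt_sq_eq_abs]
    · intro y _ hy
      split_ifs with h
      · exact absurd h hy
      · rfl
    · intro h; exact absurd (Finset.mem_univ _) h
  rw [hbl2]
  calc Real.sqrt (∑ z, Matrix.toLin' (qsK i) ω z ^ 2) ≤ Real.sqrt (pl * ω a' ^ 2) := Real.sqrt_le_sqrt hsum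
    _ = Real.sqrt pl * |ω a'| := by rw [Real.sqrt_mul hpl0.le, Real.sqrt_sq_eq_abs]

/-- **THE DIRECTION SLICE `J_μ` OF A SCALAR ON THE BOX CHART AS A LINEAR MAP**: `J_μ(ω)(b) := [b.dir = μ]·ω(b₊)`. (Written as a term; no new notion.)
[cite: Balaban1984PropagatorsI, (1.4) p.18, dictionary] -/
theorem sliceMap_apply (μ : Fin (d + 1)) (ω : SiteY i → ℝ) (b' : FBondY i) :
    (LinearMap.pi fun b' : FBondY i => (if b'.dir = μ then LinearMap.proj (R := ℝ) (φ := fun _ : SiteY i => ℝ) (boxEquiv i.hN (b'.src.shift μ)) else 0))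
      ω b' = if b'.dir = μ then ω (boxEquiv i.hN (b'.src.shift μ)) else 0 := by
  rw [LinearMap.pi_apply]
  split_ifs <;> rfl

end Sources

/-! ## §3 AT THE PINS: the `G₀Q*` block-L² letters of `Letters313L2PZ` at a configuration reading `1` -/

section QsLetters

variable {𝔸 : Type} [NormedRing 𝔸] [NormedAlgebra ℂ 𝔸] [CompleteSpace 𝔸] [FiniteDimensional ℝ 𝔸]
variable {κ : Type} [Fintype κ]
variable (i : KIdx d ℓ hd hL b₀ b₁) (b : Module.Basis κ ℝ 𝔸) (B : B9.Backgrounds) (cfg : B.Cfg → CfgY 𝔸 i) (O : BondOpY 𝔸 i) (parB : BondParY 𝔸 i)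
variable {Y W : Type}

/-- ★★ **THE REAL `G∘Q*♭` IN BLOCK-L²**: from the (2.140)₀-type torus bound of `T` (`m = 2`), `T ∘ Q*♭ : (index bonds, id) → (bonds, bI)` has the block-L² bound
`C·c·e^{¾δ(ℓ+4)}·√(e^{δ∕4}c)·(Lʲη)(a)²·e^{−¾δd}·√plateau(a′)`. [cite: Balaban1984PropagatorsII, (2.140) p.247, (2.54) p.233, Lemma 2.1 (2.61) p.234; Balaban1985BackgroundPropagators, (3.126) p.420, (3.46) p.398] -/
theorem blockBd_comp_qsK_bI {bI : FBondY i → IBondY i} (hlev : ∀ f : FBondY i, lvl i.hN i.D i.hk (bI f) = (blkV1 i.hN i.D f).1.1)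
    (hβ1 : ∀ f : FBondY i, (geomT i.D).dist (β i.hN i.D i.hk (bI f)) (blkV1 i.hN i.D f) ≤ 1)
    {T : Module.End ℝ (FBondY i → ℝ)} {C δ : ℝ} (hC : 0 ≤ C) (hδ : 0 ≤ δ) (m : ℕ)
    (hT : BlockBd (g := geomT i.D) (blkV1 i.hN i.D) (blkV1 i.hN i.D) T
      (fun y y' => C * |i.cf|⁻¹ ^ m * ((ℓ : ℝ) + 1) ^ (m * y.1.1) * Real.exp (-(δ * (geomT i.D).dist y y'))))
    {c : ℝ} (h261 : Ineq261With c (geomT i.D) δ (1 / 4)) (R₀ : ℝ) (H₀ : Prop) [Fintype (geo9K i).Site] :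
    BlockBd (g := toB6 (geo9K i) R₀ H₀) (fun a : IBondY i => a) bI (T ∘ₗ Matrix.toLin' (qsK i))
      (fun a a' => C * c * Real.exp (3 / 4 * δ * (((ℓ : ℝ) + 3) + 1)) * Real.sqrt (Real.exp (1 / 4 * δ) * c) * (geo9K i).len a ^ m *
        Real.exp (-(3 / 4 * δ * (geo9K i).dist a a')) * Real.sqrt (((((ℓ + 1 : ℕ) : ℝ) ^ (d + 1)) ^ lvl i.hN i.D i.hk a')⁻¹)) :=
  blockBd_comp_reblock i hlev hβ1 hC hδ m hT h261 R₀ H₀ (fun _ _ hω z hz => qsK_supp i hω z hz) fun _ _ hω => l2_qsK_le i hω R₀ H₀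

/-- ★★★ **THE LETTER `gQs` OF `Letters313L2PZ` AT `U = 1`** — `‖1_{Δ(y)}G₀(1)Q*(1)ω‖ ≤ B₄·Lʲη·(n_{y′}^{−1∕2}·L^{j′}η)·e^{−δ′d}·‖1_{Δ(y′)}ω‖` at ANY letter record
pinned to node00-def-Y's `GcoK … O ∕ QscoKH … parB` (the certificate's `hG0co12 ∕ hQsco12`, `hblk12 ∕ hblkZ12`), `O(1)(J ⊗ E) = (GJ) ⊗ E`, transporters
trivial at `1`, `bI` level- and 1-faithful, for members above the (2.60) threshold `log L ≤ ε(2L² − 1)M` (one power of `Lʲη` moved to the source block).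
[cite: Balaban1985BackgroundPropagators, Thm 3.13 p.426, (3.46) p.398, (3.126) p.420, p.398 (remark after (3.47)), Cor. 3.5 p.407; Balaban1984PropagatorsII, Prop. 2.6 (2.140) p.247, Lemma 2.1 (2.60)–(2.61) p.234] -/
theorem blockBd_G0_Qstar_one (hG : GeoOK (geo9K i)) [Fintype (geo9K i).Site]
    (hc : cR39 b ≠ 0) (hparB : ∀ s s', parB (fun _ _ => 1) s s' = 1)
    (hO : ∀ (J : FBondY i → ℝ) (E : 𝔸), O (fun _ _ => 1) (liftY J E) = liftY (Gop i J) E) {U₁ : B.Cfg} (hU₁ : cfg U₁ = fun _ _ => 1)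
    {bI : FBondY i → IBondY i} (hlev : ∀ f : FBondY i, lvl i.hN i.D i.hk (bI f) = (blkV1 i.hN i.D f).1.1)
    (hβ1 : ∀ f : FBondY i, (geomT i.D).dist (β i.hN i.D i.hk (bI f)) (blkV1 i.hN i.D f) ≤ 1)
    (𝔬 : Ops (geo9K i) B (XBK κ i) Y (XHK κ i) W) (hblk : 𝔬.blk = blkBK i bI) (hblkZ : 𝔬.blkZ = blkHK i)
    (hG0 : 𝔬.G0 U₁ = GcoK i b B cfg O U₁) (hQs : 𝔬.Qstar U₁ = QscoKH i b B cfg parB U₁)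
    {C δ c : ℝ} (hC : 0 ≤ C) (hδ : 0 ≤ δ) (hc0 : 0 ≤ c)
    (hT : BlockBd (g := geomT i.D) (blkV1 i.hN i.D) (blkV1 i.hN i.D) (Gop i)
      (fun y y' => C * |i.cf|⁻¹ ^ 2 * ((ℓ : ℝ) + 1) ^ (2 * y.1.1) * Real.exp (-(δ * (geomT i.D).dist y y'))))
    (h261 : Ineq261With c (geomT i.D) δ (1 / 4)) {ε : ℝ} (hε : 0 < ε)
    (hM : Real.log (geo9K i).L ≤ ε * (2 * ((ℓ : ℝ) + 1) ^ 2 - 1) * (geo9K i).M) {R₀ : ℝ} {H₀ : Prop} :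
    BlockBd (g := toB6 (geo9K i) R₀ H₀) 𝔬.blkZ 𝔬.blk (𝔬.G0 U₁ ∘ₗ 𝔬.Qstar U₁)
      (fun y y' => C * c * Real.exp (3 / 4 * δ * ((ℓ : ℝ) + 4)) * Real.sqrt (Real.exp (1 / 4 * δ) * c) * (geo9K i).L * (geo9K i).len y *
        (Real.sqrt (((((ℓ + 1 : ℕ) : ℝ) ^ (d + 1)) ^ lvl i.hN i.D i.hk y')⁻¹) * (geo9K i).len y') *
        Real.exp (-((3 / 4 * δ - ε) * (geo9K i).dist y y'))) := by
  rw [hblk, hblkZ, hG0, hQs, GcoK_comp_QscoKH_one i b B cfg O parB hc hU₁]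
  have hK := blockBd_coordOpKH_of_liftY b (G := toB6 (geo9K i) R₀ H₀) (blk' := fun a : IBondY i => a) (blk := bI)
    (T := fun _ : Fin (d + 1) => Gop i ∘ₗ Matrix.toLin' (qsK i)) (fun _ ω E => O_QsY_one_liftY i O parB hparB hO ω E) ?_
    fun _ => blockBd_comp_qsK_bI i hlev hβ1 hC hδ 2 hT h261 R₀ H₀
  swap
  · intro a a'; have := (hG.lenpos a).le; positivity
  refine B9SectDL2Decay.BlockBd.mono hK fun y y' => ?_
  -- one power of `(Lʲη)(y)` transferred to the source block: `len y ≤ L·e^{εd}·len y′`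
  have ht : (geo9K i).len y ^ 1 ≤ (geo9K i).L ^ 1 * Real.exp (ε * (geo9K i).dist y' y) * (geo9K i).len y' ^ 1 :=
    len_pow_le_of_transfer i hε 1 (by rwa [Nat.cast_one, one_mul]) y' y
  rw [pow_one, pow_one, pow_one, geo9K_dist_comm i y' y] at ht
  rw [show ((ℓ : ℝ) + 3) + 1 = (ℓ : ℝ) + 4 by ring]
  set A : ℝ := C * c * Real.exp (3 / 4 * δ * ((ℓ : ℝ) + 4)) * Real.sqrt (Real.exp (1 / 4 * δ) * c) with hA
  set v : ℝ := Real.sqrt (((((ℓ + 1 : ℕ) : ℝ) ^ (d + 1)) ^ lvl i.hN i.D i.hk y')⁻¹) with hv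
  have hA0 : 0 ≤ A := by positivity
  have hv0 : 0 ≤ v := Real.sqrt_nonneg _
  have hly : 0 ≤ (geo9K i).len y := (hG.lenpos y).le
  have hexp : Real.exp (-(3 / 4 * δ * (geo9K i).dist y y')) * Real.exp (ε * (geo9K i).dist y y') =
      Real.exp (-((3 / 4 * δ - ε) * (geo9K i).dist y y')) := by rw [← Real.exp_add]; congr 1; ring
  calc A * (geo9K i).len y ^ 2 * Real.exp (-(3 / 4 * δ * (geo9K i).dist y y')) * v
      = A * (geo9K i).len y * v * Real.exp (-(3 / 4 * δ * (geo9K i).dist y y')) * (geo9K i).len y := by ring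
    _ ≤ A * (geo9K i).len y * v * Real.exp (-(3 / 4 * δ * (geo9K i).dist y y')) * ((geo9K i).L * Real.exp (ε * (geo9K i).dist y y') * (geo9K i).len y') :=
        mul_le_mul_of_nonneg_left ht (by positivity)
    _ = A * (geo9K i).L * (geo9K i).len y * (v * (geo9K i).len y') *
          (Real.exp (-(3 / 4 * δ * (geo9K i).dist y y')) * Real.exp (ε * (geo9K i).dist y y')) := by ring
    _ = _ := by rw [hexp]

/-- ★★★ **THE LETTER `dGQs` OF `Letters313L2PZ` AT `U = 1`** — `‖1_{Δ(y)}∇_UG₀(1)Q*(1)ω‖ ≤ B₄·(√wZ y′·L^{j′}η)·e^{−δ′d}‖ω‖`, target block map `blkY = blkBK bI`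
(`hblkY12`), `D U₁ = DcoK` (`hDco12`): from the (2.140)₁ torus bound of `∇_νG` and the `Q*` source, one power of `Lʲη` transferred to the source block.
[cite: Balaban1985BackgroundPropagators, Thm 3.13 p.426, (3.46) p.398, (3.133) p.422, p.398 (remark after (3.47)), Cor. 3.5 p.407; Balaban1984PropagatorsII, Prop. 2.6 (2.140) p.247, Lemma 2.1 (2.60)–(2.61) p.234] -/
theorem blockBd_D_G0_Qstar_one (hG : GeoOK (geo9K i)) [Fintype (geo9K i).Site]
    (hc : cR39 b ≠ 0) (hparB : ∀ s s', parB (fun _ _ => 1) s s' = 1)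
    (hO : ∀ (J : FBondY i → ℝ) (E : 𝔸), O (fun _ _ => 1) (liftY J E) = liftY (Gop i J) E) {U₁ : B.Cfg} (hU₁ : cfg U₁ = fun _ _ => 1)
    {bI : FBondY i → IBondY i} (hlev : ∀ f : FBondY i, lvl i.hN i.D i.hk (bI f) = (blkV1 i.hN i.D f).1.1)
    (hβ1 : ∀ f : FBondY i, (geomT i.D).dist (β i.hN i.D i.hk (bI f)) (blkV1 i.hN i.D f) ≤ 1)
    (𝔬 : Ops (geo9K i) B (XBK κ i) (XBK κ i) (XHK κ i) W) (hblkY : 𝔬.blkY = blkBK i bI) (hblkZ : 𝔬.blkZ = blkHK i)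
    (hG0 : 𝔬.G0 U₁ = GcoK i b B cfg O U₁) (hQs : 𝔬.Qstar U₁ = QscoKH i b B cfg parB U₁) (hD : 𝔬.D U₁ = DcoK i b B cfg U₁)
    {C δ c : ℝ} (hC : 0 ≤ C) (hδ : 0 ≤ δ) (hc0 : 0 ≤ c)
    (hT : ∀ ν : Fin (d + 1), BlockBd (g := geomT i.D) (blkV1 i.hN i.D) (blkV1 i.hN i.D) (DV ν i.cf ∘ₗ Gop i)
      (fun y y' => C * |i.cf|⁻¹ ^ 1 * ((ℓ : ℝ) + 1) ^ (1 * y.1.1) * Real.exp (-(δ * (geomT i.D).dist y y'))))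
    (h261 : Ineq261With c (geomT i.D) δ (1 / 4)) {ε : ℝ} (hε : 0 < ε)
    (hM : Real.log (geo9K i).L ≤ ε * (2 * ((ℓ : ℝ) + 1) ^ 2 - 1) * (geo9K i).M) {R₀ : ℝ} {H₀ : Prop} :
    BlockBd (g := toB6 (geo9K i) R₀ H₀) 𝔬.blkZ 𝔬.blkY (𝔬.D U₁ ∘ₗ 𝔬.G0 U₁ ∘ₗ 𝔬.Qstar U₁)
      (fun y y' => C * c * Real.exp (3 / 4 * δ * ((ℓ : ℝ) + 4)) * Real.sqrt (Real.exp (1 / 4 * δ) * c) * (geo9K i).L *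
        (Real.sqrt (((((ℓ + 1 : ℕ) : ℝ) ^ (d + 1)) ^ lvl i.hN i.D i.hk y')⁻¹) * (geo9K i).len y') *
        Real.exp (-((3 / 4 * δ - ε) * (geo9K i).dist y y'))) := by
  rw [hblkY, hblkZ, hG0, hQs, hD, DcoK_GcoK_comp_QscoKH_one i b B cfg O parB hc hU₁]
  have hK := blockBd_coordOpKH_of_liftY b (G := toB6 (geo9K i) R₀ H₀) (blk' := fun a : IBondY i => a) (blk := bI)
    (T := fun ν : Fin (d + 1) => (DV ν i.cf ∘ₗ Gop i) ∘ₗ Matrix.toLin' (qsK i)) (fun ν ω E => cdB_O_QsY_one_liftY i O parB hparB hO ν ω E) ?_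
    fun ν => blockBd_comp_qsK_bI i hlev hβ1 hC hδ 1 (hT ν) h261 R₀ H₀
  swap
  · intro a a'; have := (hG.lenpos a).le; positivity
  refine B9SectDL2Decay.BlockBd.mono hK fun y y' => ?_
  have ht : (geo9K i).len y ^ 1 ≤ (geo9K i).L ^ 1 * Real.exp (ε * (geo9K i).dist y' y) * (geo9K i).len y' ^ 1 :=
    len_pow_le_of_transfer i hε 1 (by rwa [Nat.cast_one, one_mul]) y' y
  rw [pow_one, pow_one, pow_one, geo9K_dist_comm i y' y] at ht
  rw [show ((ℓ : ℝ) + 3) + 1 = (ℓ : ℝ) + 4 by ring]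
  set A : ℝ := C * c * Real.exp (3 / 4 * δ * ((ℓ : ℝ) + 4)) * Real.sqrt (Real.exp (1 / 4 * δ) * c) with hA
  set v : ℝ := Real.sqrt (((((ℓ + 1 : ℕ) : ℝ) ^ (d + 1)) ^ lvl i.hN i.D i.hk y')⁻¹) with hv
  have hA0 : 0 ≤ A := by positivity
  have hv0 : 0 ≤ v := Real.sqrt_nonneg _
  have hexp : Real.exp (-(3 / 4 * δ * (geo9K i).dist y y')) * Real.exp (ε * (geo9K i).dist y y') =
      Real.exp (-((3 / 4 * δ - ε) * (geo9K i).dist y y')) := by rw [← Real.exp_add]; congr 1; ring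
  calc A * (geo9K i).len y ^ 1 * Real.exp (-(3 / 4 * δ * (geo9K i).dist y y')) * v
      = A * v * Real.exp (-(3 / 4 * δ * (geo9K i).dist y y')) * (geo9K i).len y := by rw [pow_one]; ring
    _ ≤ A * v * Real.exp (-(3 / 4 * δ * (geo9K i).dist y y')) * ((geo9K i).L * Real.exp (ε * (geo9K i).dist y y') * (geo9K i).len y') :=
        mul_le_mul_of_nonneg_left ht (by positivity)
    _ = A * (geo9K i).L * (v * (geo9K i).len y') * (Real.exp (-(3 / 4 * δ * (geo9K i).dist y y')) * Real.exp (ε * (geo9K i).dist y y')) := by ring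
    _ = _ := by rw [hexp]

end QsLetters

end Literature.MathematicalPhysics.QuantumFieldTheory.Balaban1983to89.B9Letters313AtOneL2

end
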